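import Literature.Algebra.Homology.OrderedCechSystemAlternating
import Mathlib.Algebra.Ring.Commute
import HarnessLib

/-!
# The ordered Čech complex IS the alternating complex: the full differential formula; refinement along an arbitrary index map
# (The Stacks Project, Tag 01FG; Godement II §5.8)

Layer `Algebra/Homology`, PROOF lane (theorems only; no definition, no instance, no notation, no named fact, no `sorry`).
Sequel to `OrderedCechSystemAlternating` (definitions `inv`, `SysCochain.altEvalAt`, `refineCochain`).  Cell `hodgecm-mathlib`
FLOOR 0, P1 sub-line F-11, packet (iv)∕J3, brick F-C2 core-1 (F0P1b-p01 (g0)); consumers: F-K2 (`cross`∕`∇*` on lexicographic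
product covers), F-C2 (`p₂^♯`, `m^♯`, `sw^♯`), the bridge «ordered ≅ alternating ⊂ full».

* §1 **`inv_eq_inv_comp_succAbove_add`** — deleting one position: `inv β = inv (β ∘ δ_j) + #{i < j, β_j < β_i} + #{i > j, β_i < β_j}`;
  the parity rules `neg_one_pow_inv_mul_sign` (injective `β`: `(-1)^{inv β} ε({β}, β_j) = (-1)^j (-1)^{inv (β∘δ_j)}`) and
  `neg_one_pow_inv_add_eq_zero` (one collision `β_{j₁} = β_{j₂}`: the two surviving faces carry opposite signs).
* §2 **`SysCochain.altEvalAt_sysD`** — THE FULL (cosimplicial) ČECH DIFFERENTIAL FORMULA for the alternating extension: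
  `(d g)(β) = Σ_j (-1)^j · g(β ∘ δ_j)|` for EVERY tuple `β : Fin (m+2) → ι` ([StacksProject, Tag 01FG]: «the alternating Čech complex
  is a subcomplex of the Čech complex»).
* §3 **`sysD_refineCochain`** — refinement along an ARBITRARY map of index sets `τ : ι' → ι` commutes with the ordered Čech
  differentials (the cochain map `CochainComplex.ofHom (fun n => ModuleCat.ofHom (refineLinear τ φ n)) …` is assembled by the consumer).

## References
* The Stacks Project, Tag 01FG. [StacksProject]
* R. Godement, *Topologie algébrique et théorie des faisceaux* (1958), II §5.8. [folklore]
* U. Görtz, T. Wedhorn, *Algebraic Geometry II* (2023), Def. 21.64, Def. 21.68 (pp. 179–181). [GortzWedhorn2023]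
-/

universe v u

open CategoryTheory

set_option backward.isDefEq.respectTransparency false -- `ModuleCat`-valued functors (as in ★ `OrderedCechSystem`)

noncomputable section

namespace Literature.Algebra.Homology

namespace OrderedCech

variable {ι : Type} [LinearOrder ι]

/-! ## §1 Deleting one position from a tuple; the two parity rules -/

section Inv

variable {m : ℕ}

/-- **Deleting position `j` from a tuple `β : Fin (m+1) → ι`**: the inversions of `β` are those of `β ∘ δ_j`
(`δ_j = Fin.succAbove j`) plus the inversions involving position `j`:
`inv β = inv (β ∘ δ_j) + #{i < j | β_j < β_i} + #{i > j | β_i < β_j}`. [cite: StacksProject, Tag 01FG] -/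
theorem inv_eq_inv_comp_succAbove_add (β : Fin (m + 1) → ι) (j : Fin (m + 1)) :
    inv β = inv (β ∘ j.succAbove) + (Finset.univ.filter fun i : Fin (m + 1) => i < j ∧ β j < β i).card +
      (Finset.univ.filter fun i : Fin (m + 1) => j < i ∧ β i < β j).card := by
  classical
  unfold inv
  set P : Fin (m + 1) × Fin (m + 1) → Prop := fun pq => pq.1 < pq.2 ∧ β pq.2 < β pq.1 with hP
  set S := Finset.univ.filter P with hS
  -- split `S` according to whether the pair avoids `j`, ends at `j`, or starts at `j`
  have hsplit : S = (S.filter fun pq => pq.1 ≠ j ∧ pq.2 ≠ j) ∪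
      ((S.filter fun pq => pq.2 = j) ∪ (S.filter fun pq => pq.1 = j)) := by
    ext ⟨p, q⟩
    simp only [Finset.mem_union, Finset.mem_filter]
    constructor
    · intro h
      by_cases hp : p = j
      · exact Or.inr (Or.inr ⟨h, hp⟩)
      by_cases hq : q = j
      · exact Or.inr (Or.inl ⟨h, hq⟩)
      · exact Or.inl ⟨h, hp, hq⟩
    · rintro (h | h | h) <;> exact h.1
  have hdisj₁ : Disjoint (S.filter fun pq => pq.1 ≠ j ∧ pq.2 ≠ j)
      ((S.filter fun pq => pq.2 = j) ∪ (S.filter fun pq => pq.1 = j)) := by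
    rw [Finset.disjoint_union_right]
    constructor <;> rw [Finset.disjoint_filter] <;> intro pq _ h
    · exact fun h2 => h.2 h2
    · exact fun h1 => h.1 h1
  have hdisj₂ : Disjoint (S.filter fun pq => pq.2 = j) (S.filter fun pq => pq.1 = j) := by
    rw [Finset.disjoint_filter]
    rintro ⟨p, q⟩ hpq hq hp
    have hlt : p < q := ((Finset.mem_filter.mp hpq).2).1
    simp only at hq hp
    rw [hp, hq] at hlt
    exact lt_irrefl _ hlt
  -- pairs avoiding `j` ↔ pairs of `Fin m` through `δ_j`
  have h0 : (S.filter fun pq => pq.1 ≠ j ∧ pq.2 ≠ j).card =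
      (Finset.univ.filter fun pq : Fin m × Fin m =>
        pq.1 < pq.2 ∧ (β ∘ j.succAbove) pq.2 < (β ∘ j.succAbove) pq.1).card := by
    have himage : (S.filter fun pq => pq.1 ≠ j ∧ pq.2 ≠ j) =
        (Finset.univ.filter fun pq : Fin m × Fin m => pq.1 < pq.2 ∧ (β ∘ j.succAbove) pq.2 < (β ∘ j.succAbove) pq.1).image
          (fun pq => (j.succAbove pq.1, j.succAbove pq.2)) := by
      ext ⟨p, q⟩
      simp only [Finset.mem_filter, Finset.mem_univ, true_and, Finset.mem_image, Function.comp_apply, hS, hP]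
      constructor
      · rintro ⟨⟨hpq, hβ⟩, hp, hq⟩
        obtain ⟨p', rfl⟩ := Fin.exists_succAbove_eq hp
        obtain ⟨q', rfl⟩ := Fin.exists_succAbove_eq hq
        exact ⟨(p', q'), ⟨(Fin.strictMono_succAbove j).lt_iff_lt.mp hpq, hβ⟩, rfl⟩
      · rintro ⟨⟨p', q'⟩, ⟨hpq, hβ⟩, h⟩
        simp only [Prod.mk.injEq] at h
        obtain ⟨rfl, rfl⟩ := h
        exact ⟨⟨Fin.strictMono_succAbove j hpq, hβ⟩, Fin.succAbove_ne j p', Fin.succAbove_ne j q'⟩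
    rw [himage, Finset.card_image_of_injective]
    rintro ⟨p, q⟩ ⟨p', q'⟩ h
    simp only [Prod.mk.injEq] at h
    exact Prod.ext (Fin.succAbove_right_injective h.1) (Fin.succAbove_right_injective h.2)
  -- pairs `(i, j)` with `i < j`, `β j < β i`
  have h1 : (S.filter fun pq => pq.2 = j).card =
      (Finset.univ.filter fun i : Fin (m + 1) => i < j ∧ β j < β i).card := by
    have himage : (S.filter fun pq => pq.2 = j) =
        (Finset.univ.filter fun i : Fin (m + 1) => i < j ∧ β j < β i).image fun i => (i, j) := by
      ext ⟨p, q⟩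
      simp only [Finset.mem_filter, Finset.mem_univ, true_and, Finset.mem_image, hS, hP, Prod.mk.injEq]
      constructor
      · rintro ⟨⟨hpq, hβ⟩, rfl⟩
        exact ⟨p, ⟨hpq, hβ⟩, rfl, rfl⟩
      · rintro ⟨i, ⟨hij, hβ⟩, rfl, rfl⟩
        exact ⟨⟨hij, hβ⟩, rfl⟩
    rw [himage, Finset.card_image_of_injective]
    intro a b h
    exact (Prod.mk.inj h).1
  -- pairs `(j, i)` with `j < i`, `β i < β j`
  have h2 : (S.filter fun pq => pq.1 = j).card =
      (Finset.univ.filter fun i : Fin (m + 1) => j < i ∧ β i < β j).card := by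
    have himage : (S.filter fun pq => pq.1 = j) =
        (Finset.univ.filter fun i : Fin (m + 1) => j < i ∧ β i < β j).image fun i => (j, i) := by
      ext ⟨p, q⟩
      simp only [Finset.mem_filter, Finset.mem_univ, true_and, Finset.mem_image, hS, hP, Prod.mk.injEq]
      constructor
      · rintro ⟨⟨hpq, hβ⟩, rfl⟩
        exact ⟨q, ⟨hpq, hβ⟩, rfl, rfl⟩
      · rintro ⟨i, ⟨hij, hβ⟩, rfl, rfl⟩
        exact ⟨⟨hij, hβ⟩, rfl⟩
    rw [himage, Finset.card_image_of_injective]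
    intro a b h
    exact (Prod.mk.inj h).2
  rw [hsplit, Finset.card_union_of_disjoint hdisj₁, Finset.card_union_of_disjoint hdisj₂, h0, h1, h2]
  ring

/-- Counting with indicators: the cardinality of a filter of `Fin m` as a sum of `0∕1`. [folklore] -/
private theorem card_filter_eq_sum (m : ℕ) (p : Fin m → Prop) [DecidablePred p] :
    ((Finset.univ.filter p).card : ℤ) = ∑ i : Fin m, (if p i then 1 else 0 : ℤ) := by
  rw [Finset.card_filter]
  push_cast
  rfl

/-- `#{i : Fin (m+1) | i < j} = j`. [folklore] -/
private theorem sum_ite_lt_eq (m : ℕ) (j : Fin (m + 1)) :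
    ∑ i : Fin (m + 1), (if i < j then 1 else 0 : ℤ) = (j : ℕ) := by
  have h := card_filter_eq_sum (m + 1) (fun i => i < j)
  rw [← h]
  have : (Finset.univ.filter fun i : Fin (m + 1) => i < j) = Finset.Iio j := by
    ext i; simp
  rw [this, Fin.card_Iio]

/-- **Parity, injective case.**  For an injective tuple `β` and a position `j`, with `s = {β}`:
`inv β + #{b ∈ s | b < β_j} ≡ j + inv (β ∘ δ_j) (mod 2)`, in the form
`(-1)^{inv β} · ε(s, β_j) = (-1)^j · (-1)^{inv (β ∘ δ_j)}` (`ε` = `OrderedCech.sign`). [cite: StacksProject, Tag 01FG] -/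
theorem neg_one_pow_inv_mul_sign {A : Type u} [CommRing A] (β : Fin (m + 1) → ι) (hβ : Function.Injective β)
    (j : Fin (m + 1)) :
    (-1 : A) ^ inv β * sign A (Finset.univ.image β) (β j) = (-1) ^ (j : ℕ) * (-1) ^ inv (β ∘ j.succAbove) := by
  classical
  -- the rank of `β j` in `{β}` is `#{i | β i < β j}`
  have hrank : ((Finset.univ.image β).filter (· < β j)).card =
      (Finset.univ.filter fun i : Fin (m + 1) => β i < β j).card := by
    rw [Finset.filter_image, Finset.card_image_of_injective _ hβ]
  unfold sign
  rw [hrank, ← pow_add, ← pow_add]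
  -- parity bookkeeping with indicators
  have key : (inv β : ℤ) + ((Finset.univ.filter fun i : Fin (m + 1) => β i < β j).card : ℤ) =
      (j : ℕ) + inv (β ∘ j.succAbove) +
        2 * ((Finset.univ.filter fun i : Fin (m + 1) => j < i ∧ β i < β j).card : ℤ) := by
    rw [inv_eq_inv_comp_succAbove_add β j]
    push_cast
    rw [card_filter_eq_sum, card_filter_eq_sum, card_filter_eq_sum, ← sum_ite_lt_eq m j]
    have hpt : ∀ i : Fin (m + 1), (if i < j ∧ β j < β i then 1 else 0 : ℤ) + (if j < i ∧ β i < β j then 1 else 0 : ℤ)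
        + (if β i < β j then 1 else 0 : ℤ) =
        (if i < j then 1 else 0 : ℤ) + 2 * (if j < i ∧ β i < β j then 1 else 0 : ℤ) := by
      intro i
      rcases lt_trichotomy i j with hij | rfl | hij
      · have hne : β i ≠ β j := fun h => absurd (hβ h) (ne_of_lt hij)
        have hasym : ¬ (j < i) := lt_asymm hij
        rcases lt_or_gt_of_ne hne with hlt | hgt
        · simp [hij, hlt, lt_asymm hlt, hasym]
        · simp [hij, hgt, lt_asymm hgt, hasym]
      · simp
      · have hasym : ¬ (i < j) := lt_asymm hij
        by_cases hlt : β i < β j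
        · simp [hij, hlt, hasym]
        · simp [hij, hlt, hasym]
    have hsum := Finset.sum_congr rfl fun (i : Fin (m + 1)) (_ : i ∈ Finset.univ) => hpt i
    rw [Finset.sum_add_distrib, Finset.sum_add_distrib, Finset.sum_add_distrib, ← Finset.mul_sum] at hsum
    linarith [hsum]
  -- conclude: exponents agree modulo 2
  have hmod : (inv β + (Finset.univ.filter fun i : Fin (m + 1) => β i < β j).card) % 2 =
      ((j : ℕ) + inv (β ∘ j.succAbove)) % 2 := by
    omega
  rw [neg_one_pow_eq_pow_mod_two (R := A), hmod, ← neg_one_pow_eq_pow_mod_two (R := A)]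

/-- **Parity, one collision.**  If `β_{j₁} = β_{j₂}` (`j₁ < j₂`) and no other entry of `β` equals this value,
then the two faces `β ∘ δ_{j₁}`, `β ∘ δ_{j₂}` (the same set of indices) carry OPPOSITE signs:
`(-1)^{j₁} (-1)^{inv (β∘δ_{j₁})} + (-1)^{j₂} (-1)^{inv (β∘δ_{j₂})} = 0`. [cite: StacksProject, Tag 01FG] -/
theorem neg_one_pow_inv_add_eq_zero {A : Type u} [CommRing A] (β : Fin (m + 1) → ι) {j₁ j₂ : Fin (m + 1)}
    (hlt : j₁ < j₂) (heq : β j₁ = β j₂) (hne : ∀ i, i ≠ j₁ → i ≠ j₂ → β i ≠ β j₁) :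
    (-1 : A) ^ (j₁ : ℕ) * (-1) ^ inv (β ∘ j₁.succAbove) + (-1) ^ (j₂ : ℕ) * (-1) ^ inv (β ∘ j₂.succAbove) = 0 := by
  classical
  have key : (inv (β ∘ j₁.succAbove) : ℤ) + 2 * ((Finset.univ.filter fun i : Fin (m + 1) =>
        (j₁ < i ∧ i < j₂) ∧ β i < β j₁).card : ℤ) + (j₁ : ℕ) + 1 =
      inv (β ∘ j₂.succAbove) + (j₂ : ℕ) := by
    have h1 := inv_eq_inv_comp_succAbove_add β j₁
    have h2 := inv_eq_inv_comp_succAbove_add β j₂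
    have h12 : (inv (β ∘ j₁.succAbove) : ℤ) + (Finset.univ.filter fun i : Fin (m + 1) => i < j₁ ∧ β j₁ < β i).card
        + (Finset.univ.filter fun i : Fin (m + 1) => j₁ < i ∧ β i < β j₁).card =
        inv (β ∘ j₂.succAbove) + (Finset.univ.filter fun i : Fin (m + 1) => i < j₂ ∧ β j₂ < β i).card
        + (Finset.univ.filter fun i : Fin (m + 1) => j₂ < i ∧ β i < β j₂).card := by
      exact_mod_cast h1.symm.trans h2
    rw [card_filter_eq_sum, card_filter_eq_sum, card_filter_eq_sum, card_filter_eq_sum] at h12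
    rw [card_filter_eq_sum]
    -- `j₂ - j₁ - 1 = #{i | j₁ < i < j₂}`
    have hbetween : ∑ i : Fin (m + 1), (if j₁ < i ∧ i < j₂ then 1 else 0 : ℤ) + (j₁ : ℕ) + 1 = (j₂ : ℕ) := by
      have h := card_filter_eq_sum (m + 1) (fun i => j₁ < i ∧ i < j₂)
      rw [← h]
      have : (Finset.univ.filter fun i : Fin (m + 1) => j₁ < i ∧ i < j₂) = Finset.Ioo j₁ j₂ := by
        ext i; simp
      rw [this, Fin.card_Ioo]
      have : (j₁ : ℕ) < j₂ := hlt
      omega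
    have hpt : ∀ i : Fin (m + 1),
        (if i < j₂ ∧ β j₂ < β i then 1 else 0 : ℤ) + (if j₂ < i ∧ β i < β j₂ then 1 else 0 : ℤ)
          + 2 * (if (j₁ < i ∧ i < j₂) ∧ β i < β j₁ then 1 else 0 : ℤ) =
        (if i < j₁ ∧ β j₁ < β i then 1 else 0 : ℤ) + (if j₁ < i ∧ β i < β j₁ then 1 else 0 : ℤ)
          + (if j₁ < i ∧ i < j₂ then 1 else 0 : ℤ) := by
      intro i
      rw [← heq]
      by_cases hi1 : i = j₁
      · subst hi1
        simp [hlt]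
      by_cases hi2 : i = j₂
      · subst hi2
        simp [hlt, lt_asymm hlt, heq]
      have hβne : β i ≠ β j₁ := hne i hi1 hi2
      rcases lt_or_gt_of_ne hi1 with h1 | h1
      · -- i < j₁ < j₂
        have h2 : i < j₂ := h1.trans hlt
        by_cases hb : β j₁ < β i
        · simp [h1, h2, lt_asymm h1, lt_asymm h2, hb, lt_asymm hb]
        · simp [h1, h2, lt_asymm h1, lt_asymm h2, hb]
      · rcases lt_or_gt_of_ne hi2 with h2 | h2
        · -- j₁ < i < j₂
          rcases lt_or_gt_of_ne hβne with hb | hb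
          · simp [h1, h2, lt_asymm h1, lt_asymm h2, hb, lt_asymm hb]
          · simp [h1, h2, lt_asymm h1, lt_asymm h2, hb, lt_asymm hb]
        · -- j₁ < j₂ < i
          have h1' : j₁ < i := hlt.trans h2
          by_cases hb : β i < β j₁
          · simp [h1', h2, lt_asymm h1', lt_asymm h2, hb, lt_asymm hb]
          · simp [h1', h2, lt_asymm h1', lt_asymm h2, hb]
    have hsum := Finset.sum_congr rfl fun (i : Fin (m + 1)) (_ : i ∈ Finset.univ) => hpt i
    rw [Finset.sum_add_distrib, Finset.sum_add_distrib, Finset.sum_add_distrib, Finset.sum_add_distrib,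
      ← Finset.mul_sum] at hsum
    linarith [hsum, h12, hbetween]
  have hmod : ((j₂ : ℕ) + inv (β ∘ j₂.succAbove)) % 2 = ((j₁ : ℕ) + inv (β ∘ j₁.succAbove) + 1) % 2 := by
    omega
  rw [← pow_add, ← pow_add, neg_one_pow_eq_pow_mod_two (R := A) ((j₂ : ℕ) + _), hmod,
    ← neg_one_pow_eq_pow_mod_two (R := A), pow_succ]
  ring

end Inv

/-! ## §2 The full Čech differential formula for the alternating extension -/

section Differential

variable {A : Type u} [CommRing A] (M : Finset ι ⥤ ModuleCat.{v} A) {n : ℤ} {m : ℕ}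

/-- Deleting a position from an injective tuple deletes its value from the image. [cite: StacksProject, Tag 01FG] -/
theorem image_comp_succAbove {β : Fin (m + 1) → ι} (hβ : Function.Injective β) (j : Fin (m + 1)) :
    Finset.univ.image (β ∘ j.succAbove) = (Finset.univ.image β).erase (β j) := by
  classical
  ext x
  simp only [Finset.mem_image, Finset.mem_univ, true_and, Function.comp_apply, Finset.mem_erase]
  constructor
  · rintro ⟨i, rfl⟩
    exact ⟨fun h => Fin.succAbove_ne j i (hβ h), ⟨_, rfl⟩⟩
  · rintro ⟨hne, i, rfl⟩
    have hij : i ≠ j := fun h => hne (h ▸ rfl)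
    obtain ⟨i', rfl⟩ := Fin.exists_succAbove_eq hij
    exact ⟨i', rfl⟩

/-- A tuple with a removable collision: if `β` is not injective but `β ∘ δ_{j₀}` is, then there is exactly one
other position `j₁ ≠ j₀` with `β j₁ = β j₀`, and `β ∘ δ_j` is injective iff `j ∈ {j₀, j₁}`. [folklore] -/
private theorem exists_partner {β : Fin (m + 1) → ι} (hβ : ¬ Function.Injective β) {j₀ : Fin (m + 1)}
    (h₀ : Function.Injective (β ∘ j₀.succAbove)) :
    ∃ j₁ : Fin (m + 1), j₁ ≠ j₀ ∧ β j₁ = β j₀ ∧ (∀ i, i ≠ j₀ → i ≠ j₁ → β i ≠ β j₀) ∧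
      ∀ j, j ≠ j₀ → j ≠ j₁ → ¬ Function.Injective (β ∘ j.succAbove) := by
  -- some pair `p ≠ q` collides; one of them is `j₀`
  obtain ⟨p, q, hpq, hne⟩ : ∃ p q, β p = β q ∧ p ≠ q := by
    by_contra hcon
    push Not at hcon
    exact hβ fun p q h => hcon p q h
  have key : ∀ {p q : Fin (m + 1)}, β p = β q → p ≠ q → p = j₀ ∨ q = j₀ := by
    intro p q hpq hne
    by_contra hcon
    push Not at hcon
    obtain ⟨p', rfl⟩ := Fin.exists_succAbove_eq hcon.1
    obtain ⟨q', rfl⟩ := Fin.exists_succAbove_eq hcon.2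
    exact hne (congrArg _ (h₀ hpq))
  -- the partner
  have hpartner : ∃ j₁, j₁ ≠ j₀ ∧ β j₁ = β j₀ := by
    rcases key hpq hne with rfl | rfl
    · exact ⟨q, hne.symm, hpq.symm⟩
    · exact ⟨p, hne, hpq⟩
  obtain ⟨j₁, hj₁, hβj₁⟩ := hpartner
  refine ⟨j₁, hj₁, hβj₁, fun i hi0 hi1 h => ?_, fun j hj0 hj1 hinj => ?_⟩
  · -- a third position with the same value contradicts injectivity of `β ∘ δ_{j₀}`
    obtain ⟨i', rfl⟩ := Fin.exists_succAbove_eq hi0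
    obtain ⟨j', rfl⟩ := Fin.exists_succAbove_eq hj₁
    exact hi1 (congrArg _ (h₀ (h.trans hβj₁.symm)))
  · -- both `j₀` and `j₁` survive in `β ∘ δ_j`
    obtain ⟨a, rfl⟩ := Fin.exists_succAbove_eq (Ne.symm hj0)
    obtain ⟨b, hb⟩ := Fin.exists_succAbove_eq (Ne.symm hj1)
    have : a = b := hinj (show β (j.succAbove a) = β (j.succAbove b) by rw [hb, hβj₁])
    exact hj₁ (by rw [← hb, ← this])

/-- **The FULL Čech differential formula for the alternating extension of an ordered cochain**:
for EVERY tuple `β : Fin (m+2) → ι` (injective or not, increasing or not) and `t ⊇ {β}`,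
`(d g)(β)|_t = Σ_j (-1)^j · g(β ∘ δ_j)|_t` — i.e. the alternating extension `g ↦ (β ↦ g(β))` is a cochain map
from the ordered complex to the full (cosimplicial) Čech complex ([StacksProject, Tag 01FG]: «the alternating
Čech complex is a subcomplex of the Čech complex»). Injective `β`: reindex the ordered differential over the
positions of `β` with the parity rule `neg_one_pow_inv_mul_sign`; a repeated index: both sides vanish, the two
surviving faces cancelling by `neg_one_pow_inv_add_eq_zero`. [cite: StacksProject, Tag 01FG] [cite: GortzWedhorn2023, Def. 21.64 and Def. 21.68 (pp. 179–181)] -/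
theorem SysCochain.altEvalAt_sysD (g : SysCochain M n) (β : Fin (m + 2) → ι) (t : Finset ι)
    (ht : Finset.univ.image β ⊆ t) :
    (sysD M n g).altEvalAt β t = ∑ j : Fin (m + 2), (-1 : A) ^ (j : ℕ) • g.altEvalAt (β ∘ j.succAbove) t := by
  classical
  by_cases hβ : Function.Injective β
  · -- injective: reindex the ordered differential over positions
    rw [SysCochain.altEvalAt_of_injective _ hβ, ext0At_sysD M n g _ t ht
      (by rw [Finset.card_image_of_injective _ hβ, Finset.card_univ, Fintype.card_fin]; omega),
      Finset.smul_sum, Finset.sum_image fun i _ j _ h => hβ h]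
    refine Finset.sum_congr rfl fun j _ => ?_
    rw [SysCochain.altEvalAt_of_injective _ (hβ.comp (Fin.succAbove_right_injective)),
      image_comp_succAbove hβ, smul_smul, smul_smul, neg_one_pow_inv_mul_sign β hβ j]
  · -- a repeated index: the left side vanishes
    rw [SysCochain.altEvalAt_of_not_injective _ hβ]
    by_cases hall : ∀ j : Fin (m + 2), ¬ Function.Injective (β ∘ j.succAbove)
    · symm
      exact Finset.sum_eq_zero fun j _ => by rw [SysCochain.altEvalAt_of_not_injective _ (hall j), smul_zero]
    push Not at hall
    obtain ⟨j₀, h₀⟩ := hall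
    obtain ⟨j₁, hj₁, hβj₁, hothers, hrest⟩ := exists_partner hβ h₀
    have h₁ : Function.Injective (β ∘ j₁.succAbove) := by
      intro a b hab
      simp only [Function.comp_apply] at hab
      by_contra hne
      have hne' : j₁.succAbove a ≠ j₁.succAbove b := fun h => hne (Fin.succAbove_right_injective h)
      -- a collision away from `j₁` must involve `j₀` twice — impossible — or a third copy of the value
      rcases eq_or_ne (j₁.succAbove a) j₀ with ha | ha
      · have hb : j₁.succAbove b ≠ j₀ := fun h => hne' (ha.trans h.symm)
        exact hothers _ hb (Fin.succAbove_ne j₁ b) (hab.symm.trans (ha ▸ rfl))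
      · rcases eq_or_ne (j₁.succAbove b) j₀ with hb | hb
        · exact hothers _ ha (Fin.succAbove_ne j₁ a) (hab.trans (hb ▸ rfl))
        · -- neither is `j₀`: contradicts injectivity of `β ∘ δ_{j₀}`
          obtain ⟨a', ha'⟩ := Fin.exists_succAbove_eq ha
          obtain ⟨b', hb'⟩ := Fin.exists_succAbove_eq hb
          have : a' = b' := h₀ (show β (j₀.succAbove a') = β (j₀.succAbove b') by rw [ha', hb', hab])
          exact hne' (by rw [← ha', ← hb', this])
    -- only `j₀` and `j₁` survive
    rw [Fintype.sum_eq_add j₀ j₁ (Ne.symm hj₁) fun j hj =>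
      by rw [SysCochain.altEvalAt_of_not_injective _ (hrest j hj.1 hj.2), smul_zero]]
    rw [SysCochain.altEvalAt_of_injective _ h₀, SysCochain.altEvalAt_of_injective _ h₁, smul_smul, smul_smul]
    -- same underlying simplex
    have himage : Finset.univ.image (β ∘ j₀.succAbove) = Finset.univ.image (β ∘ j₁.succAbove) := by
      ext x
      simp only [Finset.mem_image, Finset.mem_univ, true_and, Function.comp_apply]
      constructor
      · rintro ⟨a, rfl⟩
        rcases eq_or_ne (j₀.succAbove a) j₁ with ha | ha
        · obtain ⟨b, hb⟩ := Fin.exists_succAbove_eq hj₁.symm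
          exact ⟨b, by rw [hb, ← hβj₁, ← ha]⟩
        · obtain ⟨b, hb⟩ := Fin.exists_succAbove_eq (show j₀.succAbove a ≠ j₁ from ha)
          exact ⟨b, by rw [hb]⟩
      · rintro ⟨b, rfl⟩
        rcases eq_or_ne (j₁.succAbove b) j₀ with hb | hb
        · obtain ⟨a, ha⟩ := Fin.exists_succAbove_eq hj₁
          exact ⟨a, by rw [ha, hβj₁, ← hb]⟩
        · obtain ⟨a, ha⟩ := Fin.exists_succAbove_eq hb
          exact ⟨a, by rw [ha]⟩
    rw [himage, ← add_smul]
    -- opposite signs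
    rcases lt_or_gt_of_ne (Ne.symm hj₁) with hlt | hlt
    · rw [neg_one_pow_inv_add_eq_zero β hlt hβj₁.symm (fun i hi0 hi1 => ?_), zero_smul]
      exact fun h => hothers i hi0 hi1 h
    · rw [add_comm, neg_one_pow_inv_add_eq_zero β hlt hβj₁ (fun i hi1 hi0 => ?_), zero_smul]
      exact fun h => hothers i hi0 hi1 (h.trans hβj₁)

end Differential

/-! ## §3 Refinement along an arbitrary map of index sets is a cochain map -/

section Refine

variable {ι' : Type} [LinearOrder ι'] {A : Type u} [CommRing A]
  {M : Finset ι ⥤ ModuleCat.{v} A} {M' : Finset ι' ⥤ ModuleCat.{v} A} (τ : ι' → ι) (φ : imageFunctor τ ⋙ M ⟶ M')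

/-- The rank of the `j`-th element of the sorted enumeration of `s` is `j`. [cite: StacksProject, Tag 01FG] -/
theorem card_filter_lt_orderEmbOfFin (s : Finset ι') {c : ℕ} (h : s.card = c) (j : Fin c) :
    (s.filter (· < s.orderEmbOfFin h j)).card = (j : ℕ) := by
  classical
  have he : s.filter (· < s.orderEmbOfFin h j) = (Finset.Iio j).image (s.orderEmbOfFin h) := by
    ext x
    simp only [Finset.mem_filter, Finset.mem_image, Finset.mem_Iio]
    constructor
    · rintro ⟨hx, hlt⟩
      have hx' : x ∈ Set.range (s.orderEmbOfFin h) := by rw [Finset.range_orderEmbOfFin]; exact hx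
      obtain ⟨i, rfl⟩ := hx'
      exact ⟨i, (s.orderEmbOfFin h).lt_iff_lt.mp hlt, rfl⟩
    · rintro ⟨i, hi, rfl⟩
      exact ⟨Finset.orderEmbOfFin_mem s h i, (s.orderEmbOfFin h).lt_iff_lt.mpr hi⟩
  rw [he, Finset.card_image_of_injective _ (s.orderEmbOfFin h).injective, Fin.card_Iio]

/-- The Čech sign of the `j`-th element of a simplex is `(-1)^j` (the ordered and the cosimplicial sign conventions agree).
[cite: StacksProject, Tag 01FG] [cite: GortzWedhorn2023, Def. 21.64 (p. 179)] -/
theorem sign_orderEmbOfFin (s : Finset ι') {c : ℕ} (h : s.card = c) (j : Fin c) :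
    sign A s (s.orderEmbOfFin h j) = (-1) ^ (j : ℕ) := by
  unfold sign
  rw [card_filter_lt_orderEmbOfFin]

/-- Deleting the `j`-th element: the sorted enumeration of `s ∖ e_j` is `e ∘ δ_j` (faces of increasing tuples are increasing).
[cite: StacksProject, Tag 01FG] -/
theorem orderEmbOfFin_erase (s : Finset ι') {m : ℕ} (h : s.card = m + 1) (j : Fin (m + 1))
    (h' : (s.erase (s.orderEmbOfFin h j)).card = m) :
    ⇑((s.erase (s.orderEmbOfFin h j)).orderEmbOfFin h') = s.orderEmbOfFin h ∘ j.succAbove := by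
  symm
  refine Finset.orderEmbOfFin_unique h' (fun i => ?_) ?_
  · exact Finset.mem_erase.mpr ⟨fun he => Fin.succAbove_ne j i ((s.orderEmbOfFin h).injective he),
      Finset.orderEmbOfFin_mem s h _⟩
  · exact (s.orderEmbOfFin h).strictMono.comp (Fin.strictMono_succAbove j)

/-- The proof of `s.card = c` in the sorted enumeration is irrelevant for the signed evaluation (used to pass
from the canonical `rfl` to an explicit `s.card = m + 2`). [folklore] -/
private theorem altEvalAt_orderEmbOfFin_irrel {n : ℤ} (g : SysCochain M n) (s : Finset ι') {c : ℕ} (h : s.card = c)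
    (t : Finset ι) :
    g.altEvalAt (τ ∘ ⇑(s.orderEmbOfFin rfl)) t = g.altEvalAt (τ ∘ ⇑(s.orderEmbOfFin h)) t := by
  subst h
  rfl

/-- The image of the refined tuple is `τ(s)`. [folklore] -/
private theorem image_comp_orderEmbOfFin (s : Finset ι') {c : ℕ} (h : s.card = c) :
    Finset.univ.image (τ ∘ ⇑(s.orderEmbOfFin h)) = s.image τ := by
  classical
  rw [← Finset.image_image, Finset.image_orderEmbOfFin_univ]

omit [LinearOrder ι'] in
/-- Naturality of `φ` against pushing a signed value from `τ(s')` to `τ(t')`. [folklore] -/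
private theorem map_app_altEvalAt {n : ℤ} (g : SysCochain M n) {m : ℕ} (α : Fin m → ι) {s' t' : Finset ι'}
    (hst : s' ⊆ t') (hα : Finset.univ.image α ⊆ s'.image τ) :
    (M'.map (homOfLE hst)).hom ((φ.app s').hom (g.altEvalAt α (s'.image τ))) =
      (φ.app t').hom (g.altEvalAt α (t'.image τ)) := by
  classical
  have hnat := φ.naturality (homOfLE hst)
  have h1 : (M'.map (homOfLE hst)).hom ((φ.app s').hom (g.altEvalAt α (s'.image τ))) =
      (φ.app s' ≫ M'.map (homOfLE hst)).hom (g.altEvalAt α (s'.image τ)) := rfl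
  rw [h1, ← hnat]
  change (φ.app t').hom ((M.map (homOfLE (Finset.image_subset_image hst))).hom (g.altEvalAt α (s'.image τ))) = _
  congr 1
  exact SysCochain.map_altEvalAt g α _ _ hα _

/-- Reindexing a sum over a simplex by its sorted enumeration (positions instead of vertices). [cite: StacksProject, Tag 01FG] -/
theorem sum_eq_sum_orderEmbOfFin {β : Type*} [AddCommMonoid β] (s : Finset ι') {c : ℕ} (h : s.card = c)
    (F : ι' → β) : ∑ a ∈ s, F a = ∑ j : Fin c, F (s.orderEmbOfFin h j) := by
  classical
  conv_lhs => rw [← Finset.image_orderEmbOfFin_univ s h]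
  rw [Finset.sum_image fun i _ j _ hij => (s.orderEmbOfFin h).injective hij]

/-- **Refinement along an arbitrary index map commutes with the ordered Čech differentials** — by the FULL
differential formula `altEvalAt_sysD` for the refined tuples and the rank rule `ε(s', e_j) = (-1)^j` for the
target simplex. [cite: StacksProject, Tag 01FG] [cite: GortzWedhorn2023, Def. 21.68 (p. 180)] -/
theorem sysD_refineCochain (n : ℤ) (g : SysCochain M n) :
    sysD M' n (refineCochain τ φ n g) = refineCochain τ φ (n + 1) (sysD M n g) := by
  classical
  -- negative degrees: both sides vanish
  rcases lt_or_ge n 0 with hn | hn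
  · rw [sysD_eq_zero_of_neg M' n hn, LinearMap.zero_apply]
    have h0 : sysD M n g = 0 := by rw [sysD_eq_zero_of_neg M n hn, LinearMap.zero_apply]
    rw [h0]
    exact ((refineLinear τ φ (n + 1)).map_zero).symm
  obtain ⟨m, rfl⟩ := Int.eq_ofNat_of_zero_le hn
  funext σ'
  -- the target simplex `σ'` has `m + 2` elements; enumerate it by `e := σ'.orderEmbOfFin hc`
  have hc : σ'.1.card = m + 2 := by have := σ'.2.2; omega
  rw [refineCochain_apply, altEvalAt_orderEmbOfFin_irrel τ _ σ'.1 hc,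
    SysCochain.altEvalAt_sysD M g (τ ∘ ⇑(σ'.1.orderEmbOfFin hc)) (σ'.1.image τ)
      (by rw [image_comp_orderEmbOfFin]),
    map_sum, sysD_apply, sum_eq_sum_orderEmbOfFin σ'.1 hc]
  refine Finset.sum_congr rfl fun j _ => ?_
  rw [map_smul, sign_orderEmbOfFin]
  congr 1
  -- the face `σ' ∖ e_j` is an `m`-simplex, enumerated by `e ∘ δ_j`
  have hcard' : (σ'.1.erase (σ'.1.orderEmbOfFin hc j)).card = m + 1 := by
    have := Finset.card_erase_of_mem (Finset.orderEmbOfFin_mem σ'.1 hc j); omega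
  have hσ : (σ'.1.erase (σ'.1.orderEmbOfFin hc j)).Nonempty ∧
      ((σ'.1.erase (σ'.1.orderEmbOfFin hc j)).card : ℤ) = (m : ℤ) + 1 :=
    ⟨Finset.card_pos.mp (by omega), by exact_mod_cast hcard'⟩
  rw [SysCochain.ext0At_val (refineCochain τ φ m g) ⟨σ'.1.erase (σ'.1.orderEmbOfFin hc j), hσ⟩ σ'.1
      (Finset.erase_subset _ _), refineCochain_apply]
  change (M'.map (homOfLE _)).hom ((φ.app (σ'.1.erase (σ'.1.orderEmbOfFin hc j))).hom
    (g.altEvalAt (τ ∘ ⇑((σ'.1.erase (σ'.1.orderEmbOfFin hc j)).orderEmbOfFin rfl))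
      ((σ'.1.erase (σ'.1.orderEmbOfFin hc j)).image τ))) = _
  rw [altEvalAt_orderEmbOfFin_irrel τ g _ hcard', orderEmbOfFin_erase σ'.1 hc j hcard']
  exact map_app_altEvalAt τ φ g _ (Finset.erase_subset _ _)
    (by rw [← orderEmbOfFin_erase σ'.1 hc j hcard', image_comp_orderEmbOfFin])

end Refine

end OrderedCech

end Literature.Algebra.Homology

end
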